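import Mathlib
import Literature.Analysis.ODE.InverseSquareLadder
import Literature.Analysis.ODE.InverseSquareLadderAsymptotics
import Literature.Analysis.ODE.LadderIntertwine
import Literature.Analysis.ODE.LadderBoundaryForm
import Literature.Analysis.ODE.LadderGap
import HarnessLib

/-!
# The exact ladder isometry for functions that are odd polynomials on a gap `[0, R₁]`

Analysis/ODE support file (everything proved, no definitions). Let `ι` be smooth with `ι = x⁻¹` on
`[½, ∞)`, `n ≥ 1`, and let `f` be a `C^{2n}` (resp. `C^{2n+2}`) function on `ℝ` which coincides on
`[0, R₁]` with an ODD polynomial of degree `< 2n` (so that `ladder ι n f = 0` on `(½, R₁)`) and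
vanishes on `[B, ∞)`, `½ < R < R₁ ≤ B`. Then

* `integral_sq_ladder_eq`:  `∫_R^B (ladder ι n f)² = ∫_0^B (f⁽ⁿ⁾)²`  (velocity data),
* `integral_energy_ladder_eq`:  `∫_R^B (ladder ι n f)′² + n(n+1) ι² (ladder ι n f)² = ∫_0^B (f⁽ⁿ⁺¹⁾)²`
  (position data),

with constant EXACTLY one and the right-hand integral running over the gap down to the centre
`x = 0`. Proof: the boundary-form identity of `LadderBoundaryForm.lean` on `[R, B+1]`, the
vanishing of the boundary form at `B + 1`, and its value `−∫_0^R (f⁽ⁿ⁾)²` at `R`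
(`LadderGap.lean`); the position form is the velocity form one rung up plus the exact derivative
`(n+1)(ι (ladder ι n f)²)′`. This is the exact (`c = 1`, kernel-free) counterpart of the Hardy-chain
coercivity `InverseSquareLadderCoercivity.lean`: applied to the pre-images of data supported off a
ball it yields the odd-dimensional exterior-energy IDENTITY with apex at the centre
(Duyckaerts–Kenig–Merle; Kenig–Lawrie–Liu–Schlag 2015, §2; Côte–Laurent 2024), uniformly in `n` —
route PhotonSphereChannels, `WindowedShellChannels` (stmt-FinalStateConjecture-14085), far side.
Folklore.
-/

noncomputable section

namespace Literature.Analysis.ODE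

open Set Filter Topology Finset Real Polynomial MeasureTheory

variable {ι : ℝ → ℝ}

/-! ### Vanishing beyond the support -/

/-- The ladder of a function vanishing near `x` vanishes at `x`. [folklore] -/
theorem ladder_eq_zero_of_eventuallyEq {f : ℝ → ℝ} {x : ℝ} (hf : f =ᶠ[𝓝 x] fun _ => 0) (n : ℕ) :
    ladder ι n f x = 0 := by
  have h := (ladder_eventuallyEq hf n (ι := ι)).eq_of_nhds
  rw [h, ladder_zero_fun]

/-- A function vanishing on `(B, ∞)` vanishes near every `x > B`. [folklore] -/
theorem eventuallyEq_zero_of_Ioi {f : ℝ → ℝ} {B : ℝ} (hfB : ∀ x, B ≤ x → f x = 0) {x : ℝ}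
    (hx : B < x) : f =ᶠ[𝓝 x] fun _ => 0 :=
  Filter.mem_of_superset (Ioi_mem_nhds hx) fun y hy => hfB y (le_of_lt hy)

/-- Beyond `B` the ladder of a function vanishing on `[B, ∞)` vanishes. [folklore] -/
theorem ladder_eq_zero_of_Ioi {f : ℝ → ℝ} {B : ℝ} (hfB : ∀ x, B ≤ x → f x = 0) (n : ℕ) {x : ℝ}
    (hx : B < x) : ladder ι n f x = 0 :=
  ladder_eq_zero_of_eventuallyEq (eventuallyEq_zero_of_Ioi hfB hx) n

/-- Beyond `B` the derivative of the ladder vanishes. [folklore] -/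
theorem deriv_ladder_eq_zero_of_Ioi {f : ℝ → ℝ} {B : ℝ} (hfB : ∀ x, B ≤ x → f x = 0) (n : ℕ)
    {x : ℝ} (hx : B < x) : deriv (ladder ι n f) x = 0 := by
  have hev : ladder ι n f =ᶠ[𝓝 x] fun _ => (0 : ℝ) :=
    Filter.mem_of_superset (Ioi_mem_nhds hx) fun y hy => ladder_eq_zero_of_Ioi hfB n hy
  rw [hev.deriv_eq, deriv_const]

/-- Beyond `B` the iterated derivatives vanish. [folklore] -/
theorem iteratedDeriv_eq_zero_of_Ioi {f : ℝ → ℝ} {B : ℝ} (hfB : ∀ x, B ≤ x → f x = 0) (k : ℕ)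
    {x : ℝ} (hx : B < x) : iteratedDeriv k f x = 0 := by
  rw [(eventuallyEq_zero_of_Ioi hfB hx).iteratedDeriv_eq k, iteratedDeriv_const]
  simp

/-- The integral over `[B, B+1]` of a function vanishing on `(B, ∞)` is zero. [folklore] -/
theorem intervalIntegral_eq_zero_of_Ioi {g : ℝ → ℝ} {B : ℝ} (hg : ∀ x, B < x → g x = 0) :
    ∫ x in B..(B + 1), g x = 0 := by
  have h : (∫ x in B..(B + 1), g x) = ∫ x in B..(B + 1), (0 : ℝ) := by
    refine intervalIntegral.integral_congr_ae (Filter.Eventually.of_forall fun x hx => ?_)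
    rw [uIoc_of_le (by linarith)] at hx
    exact hg x hx.1
  rw [h]; simp

/-! ### The isometries -/

/-- The Riccati relation for a smooth `ι` equal to `x⁻¹` on `[½, ∞)`. [folklore] -/
theorem riccati_of_inv (hιeq : ∀ x : ℝ, 1 / 2 ≤ x → ι x = x⁻¹) :
    ∀ x ∈ Ioi (1 / 2 : ℝ), deriv ι x = -(ι x) ^ 2 := by
  intro x hx
  have hx' : (1 / 2 : ℝ) < x := hx
  have hx0 : x ≠ 0 := by intro h; rw [h] at hx'; norm_num at hx'
  have hev : ι =ᶠ[𝓝 x] fun y => y⁻¹ :=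
    Filter.mem_of_superset (Ioi_mem_nhds hx') fun y hy => hιeq y (le_of_lt hy)
  rw [hev.deriv_eq, deriv_inv, hιeq x hx'.le]; field_simp

/-- **Exact ladder isometry, velocity data.** See the module docstring.
[cite: KenigEtAl2015, §2] -/
theorem integral_sq_ladder_eq (hι : ContDiff ℝ (⊤ : ℕ∞) ι)
    (hιeq : ∀ x : ℝ, 1 / 2 ≤ x → ι x = x⁻¹) {n : ℕ} {f : ℝ → ℝ}
    (hf : ContDiff ℝ ((2 * n : ℕ) : ℕ∞) f) {p : ℝ[X]} (hp : ∀ i, Even i → p.coeff i = 0)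
    (hpdeg : p.natDegree < 2 * n) {R R₁ B : ℝ} (hR : 1 / 2 < R) (hRR₁ : R < R₁) (hR₁B : R₁ ≤ B)
    (hfp : ∀ x ∈ Icc 0 R₁, f x = p.eval x) (hfB : ∀ x, B ≤ x → f x = 0) :
    ∫ x in R..B, (ladder ι n f x) ^ 2 = ∫ x in (0 : ℝ)..B, (iteratedDeriv n f x) ^ 2 := by
  have hn : 1 ≤ n := by
    rcases Nat.eq_zero_or_pos n with h0 | h0
    · subst h0; simp at hpdeg
    · exact h0
  have hric := riccati_of_inv hιeq
  set P : ℝ → ℝ := fun x => p.eval x with hP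
  have hf1 : ContDiff ℝ ((n + 1 : ℕ) : ℕ∞) f :=
    hf.of_le (by exact_mod_cast (by omega : n + 1 ≤ 2 * n))
  have hRB : R ≤ B + 1 := by linarith
  -- (a) the boundary-form identity on `[R, B+1]`
  have hI := integral_ladder_mul_ladder_sub_eq hι isOpen_Ioi hric n hf hf1 hRB
    (fun x hx => show (1 / 2 : ℝ) < x by linarith [hx.1])
  -- (b) the boundary form vanishes at `B + 1`
  have hB1 : ladderBdry ι n f f (B + 1) = 0 := by
    have h0 : f =ᶠ[𝓝 (B + 1)] fun _ => 0 := eventuallyEq_zero_of_Ioi hfB (by linarith)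
    rw [ladderBdry_congr_eventuallyEq n (EventuallyEq.rfl (f := ι)) h0 h0, ladderBdry_zero_left]
  -- (c) the boundary form at `R` is that of the polynomial
  have hfP : f =ᶠ[𝓝 R] P :=
    Filter.mem_of_superset (Ioo_mem_nhds (by linarith : (0 : ℝ) < R) hRR₁)
      fun y hy => hfp y ⟨hy.1.le, hy.2.le⟩
  have hRbd : ladderBdry ι n f f R = -∫ x in (0 : ℝ)..R, (iteratedDeriv n f x) ^ 2 := by
    rw [ladderBdry_congr_eventuallyEq n (EventuallyEq.rfl (f := ι)) hfP hfP,
      ladderBdry_polynomial_eq_neg_integral hιeq hp hp hpdeg hR]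
    congr 1
    refine intervalIntegral.integral_congr_ae (Filter.Eventually.of_forall fun x hx => ?_)
    rw [uIoc_of_le (by linarith : (0 : ℝ) ≤ R)] at hx
    have hfPx : f =ᶠ[𝓝 x] P :=
      Filter.mem_of_superset (Ioo_mem_nhds hx.1 (lt_of_le_of_lt hx.2 hRR₁))
        fun y hy => hfp y ⟨hy.1.le, hy.2.le⟩
    rw [hfPx.iteratedDeriv_eq n]; ring
  rw [hB1, hRbd] at hI
  -- (d) split and shrink
  have hfn : n + n = 2 * n := by ring
  have hLf : Continuous (ladder ι n f) :=
    (contDiff_ladder hι (m := n) (by rw [hfn]; exact hf)).continuous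
  have hDf : Continuous (iteratedDeriv n f) :=
    hf.continuous_iteratedDeriv n (by exact_mod_cast (by omega : n ≤ 2 * n))
  have iL : ∀ a b, IntervalIntegrable (fun x => (ladder ι n f x) ^ 2) volume a b := fun a b =>
    ((hLf.pow 2).intervalIntegrable a b)
  have iD : ∀ a b, IntervalIntegrable (fun x => (iteratedDeriv n f x) ^ 2) volume a b := fun a b =>
    ((hDf.pow 2).intervalIntegrable a b)
  have hsplit : (∫ x in R..(B + 1), (ladder ι n f x * ladder ι n f x
      - iteratedDeriv n f x * iteratedDeriv n f x))
      = (∫ x in R..(B + 1), (ladder ι n f x) ^ 2) - ∫ x in R..(B + 1), (iteratedDeriv n f x) ^ 2 := by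
    rw [← intervalIntegral.integral_sub (iL _ _) (iD _ _)]
    refine intervalIntegral.integral_congr fun x _ => ?_
    ring
  have hL0 : (∫ x in R..(B + 1), (ladder ι n f x) ^ 2) = ∫ x in R..B, (ladder ι n f x) ^ 2 := by
    rw [← intervalIntegral.integral_add_adjacent_intervals (iL R B) (iL B (B + 1)),
      intervalIntegral_eq_zero_of_Ioi (fun x hx => by rw [ladder_eq_zero_of_Ioi hfB n hx]; ring),
      add_zero]
  have hD0 : (∫ x in R..(B + 1), (iteratedDeriv n f x) ^ 2)
      = ∫ x in R..B, (iteratedDeriv n f x) ^ 2 := by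
    rw [← intervalIntegral.integral_add_adjacent_intervals (iD R B) (iD B (B + 1)),
      intervalIntegral_eq_zero_of_Ioi (fun x hx => by
        rw [iteratedDeriv_eq_zero_of_Ioi hfB n hx]; ring), add_zero]
  rw [hsplit, hL0, hD0] at hI
  have hadd := intervalIntegral.integral_add_adjacent_intervals (iD 0 R) (iD R B)
  linarith

/-- **Exact ladder isometry, position data.** See the module docstring.
[cite: KenigEtAl2015, §2] -/
theorem integral_energy_ladder_eq (hι : ContDiff ℝ (⊤ : ℕ∞) ι)
    (hιeq : ∀ x : ℝ, 1 / 2 ≤ x → ι x = x⁻¹) {n : ℕ} {f : ℝ → ℝ}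
    (hf : ContDiff ℝ ((2 * n + 2 : ℕ) : ℕ∞) f) {p : ℝ[X]} (hp : ∀ i, Even i → p.coeff i = 0)
    (hpdeg : p.natDegree < 2 * n) {R R₁ B : ℝ} (hR : 1 / 2 < R) (hRR₁ : R < R₁) (hR₁B : R₁ ≤ B)
    (hfp : ∀ x ∈ Icc 0 R₁, f x = p.eval x) (hfB : ∀ x, B ≤ x → f x = 0) :
    ∫ x in R..B, ((deriv (ladder ι n f) x) ^ 2 + n * (n + 1) * ι x ^ 2 * (ladder ι n f x) ^ 2)
      = ∫ x in (0 : ℝ)..B, (iteratedDeriv (n + 1) f x) ^ 2 := by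
  have hric := riccati_of_inv hιeq
  set P : ℝ → ℝ := fun x => p.eval x with hP
  -- velocity isometry one rung up
  have hf' : ContDiff ℝ ((2 * (n + 1) : ℕ) : ℕ∞) f := by
    have : 2 * (n + 1) = 2 * n + 2 := by ring
    rw [this]; exact hf
  have hvel := integral_sq_ladder_eq hι hιeq hf' hp (by omega) hR hRR₁ hR₁B hfp hfB
  rw [← hvel]
  -- the players
  set u : ℝ → ℝ := ladder ι n f with hu
  set c : ℝ := (n : ℝ) + 1 with hc
  have huC : ContDiff ℝ ((n + 2 : ℕ) : ℕ∞) u := by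
    refine contDiff_ladder hι (m := n + 2) ?_
    have : n + 2 + n = 2 * n + 2 := by ring
    rw [this]; exact hf
  have hu2 : ContDiff ℝ 2 u := huC.of_le (WithTop.coe_le_coe.mpr (by exact_mod_cast (by omega : 2 ≤ n + 2)))
  have hud : Differentiable ℝ u := hu2.differentiable (by norm_num)
  have hu'c : Continuous (deriv u) := hu2.continuous_deriv (by norm_num)
  have hιd : Differentiable ℝ ι := hι.differentiable (by simp)
  have hw_def : ladder ι (n + 1) f = fun y => deriv u y - c * ι y * u y := by
    funext y; rw [ladder_succ, ladderStep_apply]; push_cast; rfl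
  have hwc : Continuous (ladder ι (n + 1) f) := by
    rw [hw_def]; exact hu'c.sub ((continuous_const.mul hι.continuous).mul hu2.continuous)
  -- pointwise: position form − velocity form one rung up = c (ι u²)′
  have hkey : ∀ x ∈ Ioi (1 / 2 : ℝ), HasDerivAt (fun y => c * (ι y * u y ^ 2))
      ((deriv u x) ^ 2 + n * (n + 1) * ι x ^ 2 * (u x) ^ 2 - (ladder ι (n + 1) f x) ^ 2) x := by
    intro x hx
    have h1 : HasDerivAt (fun y => ι y * u y ^ 2)
        (deriv ι x * u x ^ 2 + ι x * (2 * u x * deriv u x)) x := by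
      have hu' := (hud x).hasDerivAt
      have := (hιd x).hasDerivAt.fun_mul (hu'.fun_pow 2)
      refine this.congr_deriv ?_
      simp only [Nat.cast_ofNat, Nat.reduceSub, pow_one]
    refine (h1.const_mul c).congr_deriv ?_
    have hwx : ladder ι (n + 1) f x = deriv u x - c * ι x * u x := by rw [hw_def]
    rw [hric x hx, hwx, hc]; ring
  have hRB : R ≤ B + 1 := by linarith
  have hcont : Continuous fun x => (deriv u x) ^ 2 + n * (n + 1) * ι x ^ 2 * (u x) ^ 2
      - (ladder ι (n + 1) f x) ^ 2 :=
    ((hu'c.pow 2).add (((continuous_const.mul continuous_const).mul (hι.continuous.pow 2)).mul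
      (hu2.continuous.pow 2))).sub (hwc.pow 2)
  have hFTC := intervalIntegral.integral_eq_sub_of_hasDerivAt
    (fun x hx => hkey x (by
      rw [uIcc_of_le hRB] at hx
      show (1 / 2 : ℝ) < x; linarith [hx.1]))
    (hcont.intervalIntegrable R (B + 1))
  -- the boundary terms vanish
  have huB : u (B + 1) = 0 := ladder_eq_zero_of_Ioi hfB n (by linarith)
  have huR : u R = 0 := by
    have hfP : f =ᶠ[𝓝 R] P :=
      Filter.mem_of_superset (Ioo_mem_nhds (by linarith : (0 : ℝ) < R) hRR₁)
        fun y hy => hfp y ⟨hy.1.le, hy.2.le⟩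
    show ladder ι n f R = 0
    rw [(ladder_eventuallyEq hfP n (ι := ι)).eq_of_nhds]
    exact ladder_polynomial_eq_zero (by norm_num : (0 : ℝ) ≤ 1 / 2)
      (fun x hx => hιeq x (le_of_lt hx)) hp hpdeg hR
  have hzero : (∫ x in R..(B + 1), ((deriv u x) ^ 2 + n * (n + 1) * ι x ^ 2 * (u x) ^ 2
      - (ladder ι (n + 1) f x) ^ 2)) = 0 := by
    rw [hFTC]; simp [huB, huR]
  -- split and shrink
  have iP : ∀ a b, IntervalIntegrable
      (fun x => (deriv u x) ^ 2 + n * (n + 1) * ι x ^ 2 * (u x) ^ 2) volume a b := fun a b =>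
    ((hu'c.pow 2).add (((continuous_const.mul continuous_const).mul (hι.continuous.pow 2)).mul
      (hu2.continuous.pow 2))).intervalIntegrable a b
  have iW : ∀ a b, IntervalIntegrable (fun x => (ladder ι (n + 1) f x) ^ 2) volume a b := fun a b =>
    (hwc.pow 2).intervalIntegrable a b
  have hsplit : (∫ x in R..(B + 1), ((deriv u x) ^ 2 + n * (n + 1) * ι x ^ 2 * (u x) ^ 2
      - (ladder ι (n + 1) f x) ^ 2))
      = (∫ x in R..(B + 1), ((deriv u x) ^ 2 + n * (n + 1) * ι x ^ 2 * (u x) ^ 2))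
        - ∫ x in R..(B + 1), (ladder ι (n + 1) f x) ^ 2 :=
    intervalIntegral.integral_sub (iP _ _) (iW _ _)
  have hP0 : (∫ x in R..(B + 1), ((deriv u x) ^ 2 + n * (n + 1) * ι x ^ 2 * (u x) ^ 2))
      = ∫ x in R..B, ((deriv u x) ^ 2 + n * (n + 1) * ι x ^ 2 * (u x) ^ 2) := by
    rw [← intervalIntegral.integral_add_adjacent_intervals (iP R B) (iP B (B + 1)),
      intervalIntegral_eq_zero_of_Ioi (fun x hx => by
        have h1 : deriv u x = 0 := deriv_ladder_eq_zero_of_Ioi hfB n hx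
        have h2 : u x = 0 := ladder_eq_zero_of_Ioi hfB n hx
        show deriv u x ^ 2 + n * (n + 1) * ι x ^ 2 * u x ^ 2 = 0
        rw [h1, h2]; ring),
      add_zero]
  have hW0 : (∫ x in R..(B + 1), (ladder ι (n + 1) f x) ^ 2)
      = ∫ x in R..B, (ladder ι (n + 1) f x) ^ 2 := by
    rw [← intervalIntegral.integral_add_adjacent_intervals (iW R B) (iW B (B + 1)),
      intervalIntegral_eq_zero_of_Ioi (fun x hx => by
        rw [ladder_eq_zero_of_Ioi hfB (n + 1) hx]; ring), add_zero]
  rw [hsplit, hP0, hW0] at hzero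
  linarith

end Literature.Analysis.ODE
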